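/-
Copyright (c) 2026 the pub-hodgecm-mathlib formalisation cell (harness21).  Prover seat hodgecm-mathlib-K2E5-p17 (g3) (free E5 hand on the E3 road),
Track B «K2-LIT» ∕ h413 (`stmt-HodgeConjecture-24833`), line `K2_E3_EllipticInputs`, unit U12-d, §L: brick (b-i) «LINE FOURIER INVERSION» of the leaf
(LBGL-2b) `sig_K2E3GL2RegularNilpotentFourier` (U12 ED. 8) — `μ_reg(𝓕f) = c · ∫_K ∫_𝔟 f(Ad(k) B) dB dk` on `𝔤𝔩₂(F)`.  2026-09-04.
-/
import Summits.HodgeConjecture.HodgeConjecture.Theorems.K2E3GL2RegularNilpotentOrbitalMeasure   -- ★ p856734 (K2E3-p12 (g3)): `integrable_comp_conjNilp` (`μ_reg` is defined on `C_c^∞`)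
import Summits.HodgeConjecture.HodgeConjecture.Theorems.K2E3GLnLieAdIntegralInvariant          -- ★ p856815 (K2E3-p12 (g3)): `integral_comp_conj_of_mem_glInt`, `continuous_conj`; ★ p856457 `isLocSmooth_matrixFourier`
import Literature.NumberTheory.Automorphic.TateSelfDualHaar                                     -- ★ Tate: `fourierSB_fourierSB_eq`, `selfDualConst`, `selfDualConst_pos`
import Literature.NumberTheory.Automorphic.LocalPiSchwartzBruhatFourier                         -- ★ `𝒮(F^ι)` structure: `exists_forall_add_eq_of_mem_schwartzBruhat_pi`, `exists_eq_zero_of_notMem_piPrimePowBall`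
import Literature.NumberTheory.Automorphic.AddCharConductorExponent                             -- ★ `AddChar.IsContinuousNontrivial.exists_hasConductorExp`
import HarnessLib

/-!
# K2_E3 road (h413), §L — (LBGL-2b), brick (b-i): LINE FOURIER INVERSION for the regular nilpotent orbital measure on `𝔤𝔩₂(F)`

Cell `pub/hodgecm-mathlib` (D-0151), Track B (21-frontier RULING «PUSH BOTH» 2026-09-03, director req624), seat K2E5-p17 (g3) — a released E5 hand working
the UN-OWNED brick (b-i) of K2E3-p12 (g3)'s §L MEMO v2 (`K2/K2E3-p12/g3/MEMO-SL-LieCores-line.v2.K2E3-p12-g3.md`) by default plan announced on the squad bus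
(2026-09-04T02:57Z; dealer K2E3-plan (g2)).  `--supports stmt-HodgeConjecture-24833 --as helper`; THEOREMS ONLY (no definition ∕ instance ∕ notation ∕ named fact ∕
`sorry`); never imports `Cruxes/…/Lines`.  COUNT-NEUTRAL: (L-B_GL) :478 of U12 stays OPEN; this file does not pay (LBGL-2b), it reduces it to the Lie–Weyl formula (b-ii).

THE LEAF (LBGL-2b) `sig_K2E3GL2RegularNilpotentFourier` (U12 ED. 8 :378 = `hB` of ★ p856788 `gl2_nilpotentFourierRegular_of_structure` verbatim) asks for a locally
integrable `F_reg` on `𝔤𝔩₂(F)`, locally constant on `{disc ≠ 0}` with `|disc|^{1/2}·|F_reg|` locally bounded, representing `μ_reg ∘ 𝓕`: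
`μ_reg(𝓕_ψ f) = ∫ f · F_reg dμ𝔤` for `f ∈ C_c^∞(𝔤𝔩₂(F))`, where `μ_reg(g) = ∫_{GL₂(𝒪) × F} g(k (tE₁₂) k⁻¹) d(κ ⊗ dx)` (★ p856734) and
`𝓕_ψ f(Y) = ∫ ψ(tr(Y X)) f(X) dμ𝔤(X)` [HarishChandra1999AdmissibleDistributions, Thm. 4.4; for `𝔤𝔩₂` explicitly `F_reg = c·|disc|^{-1/2}·1_{split r.s.}`].
The classical computation has two steps: **(b-i) line Fourier inversion** `μ_reg(𝓕_ψ f) = c · ∫_K ∫_𝔟 f(Ad(k) B) dB dk` (`𝔟` = upper triangular matrices,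
`dB = dx^{⊗3}`), and (b-ii) the Lie-algebra Weyl integration formula for the split Cartan (`∫_K ∫_𝔟 f(Ad(k)B) = c′ ∫ f·|disc|^{-1/2}·1_{split r.s.} dμ𝔤`).
THIS FILE PROVES (b-i), hypothesis-free, with an explicit positive constant:
* §1 `trace_nilp_mul`, `trace_conj_mul_conj` — `tr((k (tE₁₂) k⁻¹)(k Y k⁻¹)) = tr((tE₁₂) Y) = t · Y₁₀`.
* §2 the coordinate chart `x ↦ [[x₁, x₂],[x₀, x₃]] : F⁴ ≃ 𝔤𝔩₂(F)` (coordinate `0` = the entry `(1,0)` dual to `E₁₂` under the trace form): `continuous_chart`,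
  `continuous_chartInv`, `isAddHaarMeasure_map_chart` (so `μ𝔤 = c₂ • chart_*(dx^{⊗4})` by Haar uniqueness, `c₂ = addHaarScalarFactor μ𝔤 (chart_* dx^{⊗4})`).
* §3 **`integral_matrixFourier_conjNilp_eq`** — for `k ∈ GL₂(𝒪)` and `f ∈ C_c^∞`: `∫_F 𝓕_ψ f(k (tE₁₂) k⁻¹) dt = c₂ · q^{-m} dx(𝒪)² · ∫_{F³} f(k [[r₀,r₁],[0,r₂]] k⁻¹) dr`:
  `Ad(k)`-substitution (★ `integral_comp_conj_of_mem_glInt`) makes the integrand `ψ(t·Y₁₀) f(kYk⁻¹)`; in the chart and after splitting `F⁴ = F × F³`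
  (Mathlib `measurePreserving_piFinSuccAbove`) the `t`-integrand is `c₂ · (G_k)^(t)` with `G_k(s) = ∫_{F³} f(k [[r₀,r₁],[s,r₂]] k⁻¹) dr ∈ 𝒮(F)` (uniform local
  constancy and ball support of `f ∘ Ad(k) ∘ chart ∈ 𝒮(F⁴)`, ★ `exists_forall_add_eq_of_mem_schwartzBruhat_pi` ∕ `exists_eq_zero_of_notMem_piPrimePowBall`), and
  Tate's inversion ★ `fourierSB_fourierSB_eq` at `x = 0` reads `∫_F Ĝ(t) dt = q^{-m} dx(𝒪)² · G(0)` (`selfDualConst dx m`, `m` = conductor exponent of `ψ`).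
* §4 **`nilpotentAverage_matrixFourier_eq`** (THE HEAD) — `∃ c > 0, ∀ f ∈ C_c^∞(𝔤𝔩₂(F)), μ_reg(𝓕_ψ f) = c · ∫_K ∫_{F³} f(k [[r₀,r₁],[0,r₂]] k⁻¹) dr dκ(k)`
  (outer Fubini on `K × F` by ★ `integrable_comp_conjNilp` ∘ ★ `isLocSmooth_matrixFourier`), for every finite-on-compacts `κ` on `GL₂(𝒪)`, additive Haar `dx` on `F`
  and additive Haar `μ𝔤` on `𝔤𝔩₂(F)`; `c = c₂ · q^{-m} dx(𝒪)²`.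
With (b-i) in hand, (LBGL-2b) ⟸ (b-ii) alone: `F_reg := c · W` for the Weyl density `W = c′·|disc|^{-1/2}·1_{split r.s.}` (★ p856597 gives `|disc|^{-1/2} ∈ L¹_loc`).

References: [HarishChandra1999AdmissibleDistributions] Harish-Chandra (notes by DeBacker–Sally), *Admissible invariant distributions on reductive p-adic groups*, AMS
ULECT 16 (1999), §3 pp. 8–10, Thm. 4.4 p. 11, §7 (the Fourier transform of a nilpotent orbital integral) · [Howe1974] R. Howe, *The Fourier transform and germs of
characters*, Math. Ann. 208 (1974), §2 Prop. 3 · [Tate1950] J. Tate, *Fourier analysis in number fields and Hecke's zeta-functions*, §2.2 Thm. 2.2.2 ·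
[WeilBNT1967] A. Weil, *Basic Number Theory*, Ch. VII §2 Prop. 2 (Fourier transform on `𝒮(F^n)`), Ch. I §2 (module of an automorphism).
HONEST LABEL: HC_CM is proved only modulo the 7 printed citations (2 remaining named inputs: hLiu418 = stmt-HodgeConjecture-24832, h413 = stmt-HodgeConjecture-24833)
until rung 0 closes; count-neutral helper — (LBGL-2b) still owes the Lie–Weyl formula (b-ii).
-/

set_option autoImplicit false
set_option linter.dupNamespace false   -- `Summit.HodgeConjecture.HodgeConjecture.…` (D-0017 nested layout; lakefile exemption for Summits)

noncomputable section

open MeasureTheory Measure Filter Topology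
open scoped MatrixGroups NNReal ENNReal Pointwise
open Literature.NumberTheory.Rogawski1990 Literature.NumberTheory.Automorphic Literature.NumberTheory.Automorphic.LocalFieldHaar
open Literature.NumberTheory.GaloisRepresentations Literature.NumberTheory.GaloisRepresentations.IsNonarchimedeanLocalField
open Summit.HodgeConjecture.HodgeConjecture.Cruxes.H413.K2E3GL2RegularNilpotentOrbitalMeasure
open Summit.HodgeConjecture.HodgeConjecture.Cruxes.H413.K2E3GLnLieAdIntegralInvariant
open Summit.HodgeConjecture.HodgeConjecture.Cruxes.H413.K2E3GLnNilpotentFourierPointSupport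

namespace Summit.HodgeConjecture.HodgeConjecture.Cruxes.H413.K2E3GL2RegularNilpotentFourierLineInversion

variable {F : Type*} [Field F] [ValuativeRel F] [TopologicalSpace F] [IsNonarchimedeanLocalField F]

/-! ## §1  Trace identities: `tr((k (tE₁₂) k⁻¹)(k Y k⁻¹)) = t · Y₁₀` -/

omit [ValuativeRel F] [TopologicalSpace F] [IsNonarchimedeanLocalField F] in
/-- `tr((tE₁₂) · Y) = t · Y₁₀`: the trace form pairs `E₁₂` with the `(1,0)` matrix entry. [cite: HarishChandra1999AdmissibleDistributions, §4 p. 11] -/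
theorem trace_nilp_mul (t : F) (Y : Matrix (Fin 2) (Fin 2) F) :
    Matrix.trace ((!![0, t; 0, 0] : Matrix (Fin 2) (Fin 2) F) * Y) = t * Y 1 0 := by
  rw [Matrix.trace_fin_two, Matrix.mul_apply, Matrix.mul_apply]
  simp [Fin.sum_univ_two]

omit [ValuativeRel F] [TopologicalSpace F] [IsNonarchimedeanLocalField F] in
/-- `tr((k A k⁻¹)(k Y k⁻¹)) = tr(A Y)` (`Ad`-invariance of the trace form). [cite: HarishChandra1999AdmissibleDistributions, §3 p. 8] -/
theorem trace_conj_mul_conj (k : GL (Fin 2) F) (A Y : Matrix (Fin 2) (Fin 2) F) :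
    Matrix.trace (((k : Matrix (Fin 2) (Fin 2) F) * A * ((k⁻¹ : GL (Fin 2) F) : Matrix (Fin 2) (Fin 2) F)) *
        ((k : Matrix (Fin 2) (Fin 2) F) * Y * ((k⁻¹ : GL (Fin 2) F) : Matrix (Fin 2) (Fin 2) F))) = Matrix.trace (A * Y) := by
  have hkk : ((k⁻¹ : GL (Fin 2) F) : Matrix (Fin 2) (Fin 2) F) * (k : Matrix (Fin 2) (Fin 2) F) = 1 := by
    rw [← Units.val_mul, inv_mul_cancel, Units.val_one]
  have h1 : (k : Matrix (Fin 2) (Fin 2) F) * A * ((k⁻¹ : GL (Fin 2) F) : Matrix (Fin 2) (Fin 2) F) *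
        ((k : Matrix (Fin 2) (Fin 2) F) * Y * ((k⁻¹ : GL (Fin 2) F) : Matrix (Fin 2) (Fin 2) F)) =
      (k : Matrix (Fin 2) (Fin 2) F) * (A * Y * ((k⁻¹ : GL (Fin 2) F) : Matrix (Fin 2) (Fin 2) F)) := by
    simp only [Matrix.mul_assoc]
    rw [← Matrix.mul_assoc ((k⁻¹ : GL (Fin 2) F) : Matrix (Fin 2) (Fin 2) F) (k : Matrix (Fin 2) (Fin 2) F), hkk, Matrix.one_mul]
  rw [h1, Matrix.trace_mul_comm, Matrix.mul_assoc (A * Y), hkk, Matrix.mul_one]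

/-! ## §2  The coordinate chart `x ↦ [[x₁, x₂],[x₀, x₃]] : F⁴ ≃ 𝔤𝔩₂(F)` -/

omit [Field F] [ValuativeRel F] [IsNonarchimedeanLocalField F] in
/-- The chart `x ↦ [[x₁, x₂],[x₀, x₃]]` is continuous. [folklore] -/
theorem continuous_chart :
    Continuous fun x : Fin 4 → F => (!![x 1, x 2; x 0, x 3] : Matrix (Fin 2) (Fin 2) F) := by
  refine continuous_matrix fun i j => ?_
  fin_cases i <;> fin_cases j <;> simp <;> exact continuous_apply _

omit [Field F] [ValuativeRel F] [IsNonarchimedeanLocalField F] in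
/-- The inverse chart `Y ↦ (Y₁₀, Y₀₀, Y₀₁, Y₁₁)` is continuous. [folklore] -/
theorem continuous_chartInv :
    Continuous fun Y : Matrix (Fin 2) (Fin 2) F => (![Y 1 0, Y 0 0, Y 0 1, Y 1 1] : Fin 4 → F) := by
  refine continuous_pi fun i => ?_
  fin_cases i <;> simp <;> exact (continuous_apply _).comp (continuous_apply _)

section Haar
variable [MeasurableSpace F] [BorelSpace F] [MeasurableSpace (Matrix (Fin 2) (Fin 2) F)] [BorelSpace (Matrix (Fin 2) (Fin 2) F)]

/-- **The chart image of `dx^{⊗4}` is an additive Haar measure on `𝔤𝔩₂(F)`** (the chart is a bi-continuous additive isomorphism). [cite: WeilBNT1967, Ch. I §2] -/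
theorem isAddHaarMeasure_map_chart (dx : Measure F) [dx.IsAddHaarMeasure] :
    (Measure.map (fun x : Fin 4 → F => (!![x 1, x 2; x 0, x 3] : Matrix (Fin 2) (Fin 2) F)) (Measure.pi fun _ : Fin 4 => dx)).IsAddHaarMeasure := by
  haveI : T2Space F := (isLocalField F).toT2Space
  haveI : LocallyCompactSpace F := (isLocalField F).toLocallyCompactSpace
  haveI : SecondCountableTopology F := secondCountableTopology_localField F
  let φ : (Fin 4 → F) ≃+ Matrix (Fin 2) (Fin 2) F :=
    { toFun := fun x => !![x 1, x 2; x 0, x 3]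
      invFun := fun Y => ![Y 1 0, Y 0 0, Y 0 1, Y 1 1]
      left_inv := fun x => by funext i; fin_cases i <;> simp
      right_inv := fun Y => by ext i j; fin_cases i <;> fin_cases j <;> simp
      map_add' := fun x y => by ext i j; fin_cases i <;> fin_cases j <;> simp }
  have hφ : (φ : (Fin 4 → F) → Matrix (Fin 2) (Fin 2) F) = fun x => !![x 1, x 2; x 0, x 3] := rfl
  rw [← hφ]
  exact AddEquiv.isAddHaarMeasure_map _ φ continuous_chart continuous_chartInv

end Haar

/-! ## §3  The `t`-integral for a fixed `k ∈ GL₂(𝒪)`: `∫_F 𝓕f(k (tE₁₂) k⁻¹) dt = c · ∫_{F³} f(k [[r₀,r₁],[0,r₂]] k⁻¹) dr` -/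

section Line
variable [MeasurableSpace F] [BorelSpace F] [MeasurableSpace (Matrix (Fin 2) (Fin 2) F)] [BorelSpace (Matrix (Fin 2) (Fin 2) F)]

/-- **Line Fourier inversion for one `k ∈ GL₂(𝒪)`**: for `f ∈ C_c^∞(𝔤𝔩₂(F))`, `ψ` continuous non-trivial of conductor exponent `m`, `dx` an additive Haar measure on
`F` and `μ𝔤` one on `𝔤𝔩₂(F)`,
there is ONE constant `c > 0` — namely `c = c₂ · q^{-m} dx(𝒪)²`, `c₂ = addHaarScalarFactor μ𝔤 (chart_* dx^{⊗4})`, `m` the conductor exponent of `ψ` — with, for every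
`k ∈ GL₂(𝒪)` and every `f ∈ C_c^∞`, `∫_F 𝓕_ψ f(k (tE₁₂) k⁻¹) dx(t) = c · ∫_{F³} f(k [[r₀, r₁],[0, r₂]] k⁻¹) dx^{⊗3}(r)`:
after the substitution `X = kYk⁻¹` the Fourier phase is `ψ(t·Y₁₀)`, the `t`-integrand is `c₂·Ĝ(t)` for the Schwartz–Bruhat fibre integral `G(s) = ∫ f(k[[r₀,r₁],[s,r₂]]k⁻¹) dr`,
and Tate's inversion formula at `0` gives `∫ Ĝ = q^{-m} dx(𝒪)²·G(0)`.
[cite: HarishChandra1999AdmissibleDistributions, Thm. 4.4 p. 11] [cite: Tate1950, §2.2 Thm. 2.2.2] [cite: WeilBNT1967, Ch. VII §2 Prop. 2] -/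
theorem integral_matrixFourier_conjNilp_eq (ψ : AddChar F Circle) (hψ : ψ.IsContinuousNontrivial)
    (μ𝔤 : Measure (Matrix (Fin 2) (Fin 2) F)) [μ𝔤.IsAddHaarMeasure] (dx : Measure F) [dx.IsAddHaarMeasure] :
    ∃ c : ℝ, 0 < c ∧ ∀ ⦃k : GL (Fin 2) F⦄, k ∈ glInt 2 F → ∀ ⦃f : Matrix (Fin 2) (Fin 2) F → ℂ⦄, IsLocSmooth f →
      ∫ t, (fun Y : Matrix (Fin 2) (Fin 2) F => ∫ X, ((ψ (Matrix.trace (Y * X)) : Circle) : ℂ) * f X ∂μ𝔤)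
          ((k : Matrix (Fin 2) (Fin 2) F) * !![0, t; 0, 0] * ((k⁻¹ : GL (Fin 2) F) : Matrix (Fin 2) (Fin 2) F)) ∂dx =
        (c : ℂ) * ∫ r : Fin 3 → F, f ((k : Matrix (Fin 2) (Fin 2) F) * !![r 0, r 1; 0, r 2] * ((k⁻¹ : GL (Fin 2) F) : Matrix (Fin 2) (Fin 2) F))
          ∂(Measure.pi fun _ : Fin 3 => dx) := by
  classical
  haveI : T2Space F := (isLocalField F).toT2Space
  haveI : LocallyCompactSpace F := (isLocalField F).toLocallyCompactSpace
  haveI : SecondCountableTopology F := secondCountableTopology_localField F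
  haveI : LocallyCompactSpace (Matrix (Fin 2) (Fin 2) F) := Pi.locallyCompactSpace_of_finite
  haveI : SecondCountableTopology (Matrix (Fin 2) (Fin 2) F) := inferInstanceAs (SecondCountableTopology (Fin 2 → Fin 2 → F))
  obtain ⟨m, hm⟩ := hψ.exists_hasConductorExp
  -- Haar uniqueness: `μ𝔤 = c₂ • chart_* dx^{⊗4}`
  set ν : Measure (Matrix (Fin 2) (Fin 2) F) :=
    Measure.map (fun x : Fin 4 → F => (!![x 1, x 2; x 0, x 3] : Matrix (Fin 2) (Fin 2) F)) (Measure.pi fun _ : Fin 4 => dx) with hν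
  haveI : ν.IsAddHaarMeasure := isAddHaarMeasure_map_chart dx
  have huniq : μ𝔤 = μ𝔤.addHaarScalarFactor ν • ν := isAddLeftInvariant_eq_smul μ𝔤 ν
  set c₂ : ℝ≥0 := μ𝔤.addHaarScalarFactor ν with hc₂
  have hc₂pos : 0 < c₂ := addHaarScalarFactor_pos_of_isAddHaarMeasure μ𝔤 ν
  refine ⟨(c₂ : ℝ) * selfDualConst dx m, mul_pos (NNReal.coe_pos.2 hc₂pos) (selfDualConst_pos dx), fun k hk f hf => ?_⟩
  -- the chart as a homeomorphism / measurable equivalence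
  let eH : (Fin 4 → F) ≃ₜ Matrix (Fin 2) (Fin 2) F :=
    { toFun := fun x => !![x 1, x 2; x 0, x 3]
      invFun := fun Y => ![Y 1 0, Y 0 0, Y 0 1, Y 1 1]
      left_inv := fun x => by funext i; fin_cases i <;> simp
      right_inv := fun Y => by ext i j; fin_cases i <;> fin_cases j <;> simp
      continuous_toFun := continuous_chart
      continuous_invFun := continuous_chartInv }
  let e : (Fin 4 → F) ≃ᵐ Matrix (Fin 2) (Fin 2) F := eH.toMeasurableEquiv
  have he : (e : (Fin 4 → F) → Matrix (Fin 2) (Fin 2) F) = fun x => !![x 1, x 2; x 0, x 3] := rfl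
  have hex : ∀ x : Fin 4 → F, e x = !![x 1, x 2; x 0, x 3] := fun x => rfl
  -- `Ad(k)` as a homeomorphism (for the compact support of `f ∘ Ad(k) ∘ chart`)
  have hkk : ((k⁻¹ : GL (Fin 2) F) : Matrix (Fin 2) (Fin 2) F) * (k : Matrix (Fin 2) (Fin 2) F) = 1 := by
    rw [← Units.val_mul, inv_mul_cancel, Units.val_one]
  have hkk' : (k : Matrix (Fin 2) (Fin 2) F) * ((k⁻¹ : GL (Fin 2) F) : Matrix (Fin 2) (Fin 2) F) = 1 := by
    rw [← Units.val_mul, mul_inv_cancel, Units.val_one]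
  let cH : Matrix (Fin 2) (Fin 2) F ≃ₜ Matrix (Fin 2) (Fin 2) F :=
    { toFun := fun X => (k : Matrix (Fin 2) (Fin 2) F) * X * ((k⁻¹ : GL (Fin 2) F) : Matrix (Fin 2) (Fin 2) F)
      invFun := fun X => ((k⁻¹ : GL (Fin 2) F) : Matrix (Fin 2) (Fin 2) F) * X * (k : Matrix (Fin 2) (Fin 2) F)
      left_inv := fun X => by
        simp only [← Matrix.mul_assoc, hkk, Matrix.one_mul]
        rw [Matrix.mul_assoc, hkk, Matrix.mul_one]
      right_inv := fun X => by
        simp only [← Matrix.mul_assoc, hkk', Matrix.one_mul]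
        rw [Matrix.mul_assoc, hkk', Matrix.mul_one]
      continuous_toFun := continuous_conj k
      continuous_invFun := by
        have h := continuous_conj (F := F) k⁻¹
        simp only [inv_inv] at h
        exact h }
  -- the transported test function `Φ = f ∘ Ad(k) ∘ chart ∈ 𝒮(F⁴)`
  set Φ : (Fin 4 → F) → ℂ :=
    fun x => f ((k : Matrix (Fin 2) (Fin 2) F) * e x * ((k⁻¹ : GL (Fin 2) F) : Matrix (Fin 2) (Fin 2) F)) with hΦ
  have hΦSB : Φ ∈ SchwartzBruhat (Fin 4 → F) := by
    rw [mem_schwartzBruhat_iff]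
    exact ⟨hf.isLocallyConstant.comp_continuous ((continuous_conj k).comp continuous_chart),
      hf.hasCompactSupport.comp_homeomorph (eH.trans cH)⟩
  -- splitting off the coordinate `0`: `F⁴ ≃ F × F³`
  let e0 : (Fin 4 → F) ≃ᵐ F × (Fin 3 → F) := MeasurableEquiv.piFinSuccAbove (fun _ : Fin 4 => F) 0
  have he0 : MeasurePreserving e0 (Measure.pi fun _ : Fin 4 => dx) (dx.prod (Measure.pi fun _ : Fin 3 => dx)) :=
    measurePreserving_piFinSuccAbove (fun _ : Fin 4 => dx) 0
  -- the Schwartz–Bruhat fibre integral `G`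
  set G : F → ℂ := fun s => ∫ r : Fin 3 → F, Φ (e0.symm (s, r)) ∂(Measure.pi fun _ : Fin 3 => dx) with hG
  have hGSB : G ∈ SchwartzBruhat F := by
    obtain ⟨N, hN⟩ := exists_forall_add_eq_of_mem_schwartzBruhat_pi hΦSB
    obtain ⟨n₀, hn₀⟩ := exists_eq_zero_of_notMem_piPrimePowBall hΦSB
    rw [mem_schwartzBruhat_iff]
    refine ⟨?_, ?_⟩
    · rw [IsLocallyConstant.iff_exists_open]
      intro s
      refine ⟨s +ᵥ primePowBall F N, (isOpen_primePowBall N).vadd s,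
        Set.mem_vadd_set.2 ⟨0, zero_mem_primePowBall N, by simp⟩, ?_⟩
      rintro s' ⟨u, hu, rfl⟩
      simp only [hG, vadd_eq_add]
      refine integral_congr_ae (Filter.Eventually.of_forall fun r => ?_)
      have hsplit : e0.symm (s + u, r) = e0.symm (s, r) + e0.symm (u, 0) := by
        funext j
        refine Fin.cases ?_ (fun i => ?_) j <;> simp [e0]
      show Φ (e0.symm (s + u, r)) = Φ (e0.symm (s, r))
      rw [hsplit]
      refine hN _ _ (mem_piPrimePowBall_iff.2 fun i => ?_)
      refine Fin.cases ?_ (fun j => ?_) i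
      · simpa [e0] using hu
      · simpa [e0] using zero_mem_primePowBall N
    · refine HasCompactSupport.intro' (isCompact_primePowBall n₀) (isClosed_primePowBall n₀) fun s hs => ?_
      simp only [hG]
      have hzero : (fun r : Fin 3 → F => Φ (e0.symm (s, r))) = fun _ => 0 := by
        funext r
        refine hn₀ _ fun h => hs ?_
        simpa [e0] using (mem_piPrimePowBall_iff.1 h) 0
      rw [hzero, integral_zero]
  -- STEP 1 (`Ad(k)`-substitution): `𝓕f(k (tE₁₂) k⁻¹) = ∫ ψ(t·Y₁₀) f(kYk⁻¹) dμ𝔤(Y)`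
  have step1 : ∀ t : F,
      (∫ X, ((ψ (Matrix.trace (((k : Matrix (Fin 2) (Fin 2) F) * !![0, t; 0, 0] * ((k⁻¹ : GL (Fin 2) F) : Matrix (Fin 2) (Fin 2) F)) * X)) : Circle) : ℂ) *
          f X ∂μ𝔤) =
        ∫ Y, ((ψ (t * Y 1 0) : Circle) : ℂ) * f ((k : Matrix (Fin 2) (Fin 2) F) * Y * ((k⁻¹ : GL (Fin 2) F) : Matrix (Fin 2) (Fin 2) F)) ∂μ𝔤 := by
    intro t
    rw [← integral_comp_conj_of_mem_glInt μ𝔤 hk (fun X => ((ψ (Matrix.trace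
      (((k : Matrix (Fin 2) (Fin 2) F) * !![0, t; 0, 0] * ((k⁻¹ : GL (Fin 2) F) : Matrix (Fin 2) (Fin 2) F)) * X)) : Circle) : ℂ) * f X)]
    refine integral_congr_ae (Filter.Eventually.of_forall fun Y => ?_)
    simp only
    rw [trace_conj_mul_conj, trace_nilp_mul]
  -- STEP 2 (chart): `∫ g dμ𝔤 = c₂ • ∫ g ∘ chart d(dx^{⊗4})`
  have step2 : ∀ g : Matrix (Fin 2) (Fin 2) F → ℂ,
      ∫ Y, g Y ∂μ𝔤 = ((c₂ : ℝ) : ℂ) * ∫ x : Fin 4 → F, g (e x) ∂(Measure.pi fun _ : Fin 4 => dx) := by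
    intro g
    rw [← integral_map_equiv e g]
    conv_lhs => rw [huniq]
    rw [integral_smul_nnreal_measure, NNReal.smul_def, Complex.real_smul]
    rfl
  -- STEP 3 (split + Fubini): the `t`-integrand is `c₂ • Ĝ(t)`
  have step3 : ∀ t : F,
      (∫ x : Fin 4 → F, ((ψ (t * (e x) 1 0) : Circle) : ℂ) *
          f ((k : Matrix (Fin 2) (Fin 2) F) * e x * ((k⁻¹ : GL (Fin 2) F) : Matrix (Fin 2) (Fin 2) F)) ∂(Measure.pi fun _ : Fin 4 => dx)) =
        fourierSB ψ dx G t := by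
    intro t
    -- the integrand on `F⁴` and its transport to `F × F³`
    have he10 : ∀ x : Fin 4 → F, (e x) 1 0 = x 0 := fun x => by simp [hex]
    have hgt_cont : Continuous fun x : Fin 4 → F => ((ψ (t * (e x) 1 0) : Circle) : ℂ) * Φ x := by
      refine Continuous.mul ?_ (hf.continuous.comp ((continuous_conj k).comp continuous_chart))
      refine continuous_subtype_val.comp (hψ.1.comp (continuous_const.mul ?_))
      simp only [he10]
      exact continuous_apply 0
    have hgt_cs : HasCompactSupport fun x : Fin 4 → F => ((ψ (t * (e x) 1 0) : Circle) : ℂ) * Φ x :=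
      ((mem_schwartzBruhat_iff.1 hΦSB).2).mul_left
    have hgt_int : Integrable (fun x : Fin 4 → F => ((ψ (t * (e x) 1 0) : Circle) : ℂ) * Φ x) (Measure.pi fun _ : Fin 4 => dx) :=
      hgt_cont.integrable_of_hasCompactSupport hgt_cs
    have htrans : (∫ x : Fin 4 → F, ((ψ (t * (e x) 1 0) : Circle) : ℂ) * Φ x ∂(Measure.pi fun _ : Fin 4 => dx)) =
        ∫ p : F × (Fin 3 → F), ((ψ (t * p.1) : Circle) : ℂ) * Φ (e0.symm p) ∂(dx.prod (Measure.pi fun _ : Fin 3 => dx)) := by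
      rw [← (he0.symm e0).integral_comp']
      refine integral_congr_ae (Filter.Eventually.of_forall fun p => ?_)
      simp only [hex]
      congr 4
    have hint' : Integrable (fun p : F × (Fin 3 → F) => ((ψ (t * p.1) : Circle) : ℂ) * Φ (e0.symm p))
        (dx.prod (Measure.pi fun _ : Fin 3 => dx)) := by
      have h := ((he0.symm e0).integrable_comp_emb e0.symm.measurableEmbedding).2 hgt_int
      refine h.congr (Filter.Eventually.of_forall fun p => ?_)
      simp only [Function.comp_apply, hex]
      congr 4
    show (∫ x : Fin 4 → F, ((ψ (t * (e x) 1 0) : Circle) : ℂ) * Φ x ∂(Measure.pi fun _ : Fin 4 => dx)) = fourierSB ψ dx G t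
    rw [htrans, integral_prod _ hint', fourierSB_apply]
    refine integral_congr_ae (Filter.Eventually.of_forall fun s => ?_)
    simp only [hG]
    rw [integral_const_mul, mul_comm s t]
  -- STEP 4 (Tate's inversion at `0`): `∫ Ĝ = q^{-m} dx(𝒪)² · G(0)`
  have step4 : ∫ t, fourierSB ψ dx G t ∂dx = (selfDualConst dx m : ℂ) * G 0 := by
    have h := congr_fun (fourierSB_fourierSB_eq dx hψ.1 hm hGSB) 0
    rw [fourierSB_apply, neg_zero] at h
    simpa using h
  -- STEP 5: `G(0) = ∫ f(k [[r₀,r₁],[0,r₂]] k⁻¹) dr`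
  have step5 : G 0 = ∫ r : Fin 3 → F, f ((k : Matrix (Fin 2) (Fin 2) F) * !![r 0, r 1; 0, r 2] * ((k⁻¹ : GL (Fin 2) F) : Matrix (Fin 2) (Fin 2) F))
      ∂(Measure.pi fun _ : Fin 3 => dx) := by
    simp only [hG, hΦ]
    refine integral_congr_ae (Filter.Eventually.of_forall fun r => ?_)
    have hmat : e (e0.symm (0, r)) = !![r 0, r 1; 0, r 2] := by
      rw [hex]
      ext i j
      fin_cases i <;> fin_cases j <;> simp [e0] <;> rfl
    simp only [hmat]
  -- ASSEMBLY
  calc ∫ t, (fun Y : Matrix (Fin 2) (Fin 2) F => ∫ X, ((ψ (Matrix.trace (Y * X)) : Circle) : ℂ) * f X ∂μ𝔤)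
          ((k : Matrix (Fin 2) (Fin 2) F) * !![0, t; 0, 0] * ((k⁻¹ : GL (Fin 2) F) : Matrix (Fin 2) (Fin 2) F)) ∂dx
      = ∫ t, ((c₂ : ℝ) : ℂ) * fourierSB ψ dx G t ∂dx := by
        refine integral_congr_ae (Filter.Eventually.of_forall fun t => ?_)
        simp only
        rw [step1 t, step2, step3 t]
    _ = ((c₂ : ℝ) : ℂ) * ∫ t, fourierSB ψ dx G t ∂dx := integral_const_mul _ _
    _ = _ := by
        rw [step4, step5]
        push_cast
        ring

end Line

/-! ## §4  THE HEAD: `μ_reg(𝓕_ψ f) = c · ∫_K ∫_{F³} f(k [[r₀,r₁],[0,r₂]] k⁻¹) dr dκ(k)` -/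

section Head
variable [MeasurableSpace F] [BorelSpace F] [MeasurableSpace (GL (Fin 2) F)] [BorelSpace (GL (Fin 2) F)]
  [MeasurableSpace (Matrix (Fin 2) (Fin 2) F)] [BorelSpace (Matrix (Fin 2) (Fin 2) F)]

/-- **(b-i) LINE FOURIER INVERSION — `μ_reg(𝓕_ψ f) = c · ∫_K ∫_𝔟 f(Ad(k) B) dB dk`.**  For `ψ` continuous non-trivial, `μ𝔤` an additive Haar measure on `𝔤𝔩₂(F)`,
`κ` a finite-on-compacts measure on `K = GL₂(𝒪)` and `dx` an additive Haar measure on `F`, there is ONE constant `c > 0` (namely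
`c = addHaarScalarFactor μ𝔤 (chart_* dx^{⊗4}) · q^{-m} dx(𝒪)²`, `m` the conductor exponent of `ψ`) such that for every `f ∈ C_c^∞(𝔤𝔩₂(F))`
`∫_{K × F} (𝓕_ψ f)(k (tE₁₂) k⁻¹) d(κ ⊗ dx) = c · ∫_K ∫_{F³} f(k [[r₀, r₁],[0, r₂]] k⁻¹) dx^{⊗3}(r) dκ(k)` — the regular nilpotent orbital measure of a Fourier
transform is `c` times the `K`-average of the integral over the BOREL SUBALGEBRA `𝔟` (upper triangular matrices).  With the Lie–Weyl formula (b-ii) for `K × 𝔟 → 𝔤𝔩₂`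
this is Harish-Chandra's `μ̂_reg = c·|disc|^{-1/2}·1_{split r.s.}`.
[cite: HarishChandra1999AdmissibleDistributions, Thm. 4.4 p. 11] [cite: Howe1974, §2 Prop. 3] [cite: Tate1950, §2.2 Thm. 2.2.2] [cite: WeilBNT1967, Ch. VII §2 Prop. 2] -/
theorem nilpotentAverage_matrixFourier_eq (ψ : AddChar F Circle) (hψ : ψ.IsContinuousNontrivial)
    (μ𝔤 : Measure (Matrix (Fin 2) (Fin 2) F)) [μ𝔤.IsAddHaarMeasure]
    (κ : Measure ↥(glInt 2 F)) [IsFiniteMeasureOnCompacts κ] (dx : Measure F) [dx.IsAddHaarMeasure] :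
    ∃ c : ℝ, 0 < c ∧ ∀ f : Matrix (Fin 2) (Fin 2) F → ℂ, IsLocSmooth f →
      ∫ p : ↥(glInt 2 F) × F, (fun Y : Matrix (Fin 2) (Fin 2) F => ∫ X, ((ψ (Matrix.trace (Y * X)) : Circle) : ℂ) * f X ∂μ𝔤)
          (((p.1 : GL (Fin 2) F) : Matrix (Fin 2) (Fin 2) F) * !![0, p.2; 0, 0] * ((((p.1 : GL (Fin 2) F))⁻¹ : GL (Fin 2) F) : Matrix (Fin 2) (Fin 2) F))
          ∂(κ.prod dx) =
        c * ∫ k : ↥(glInt 2 F), ∫ r : Fin 3 → F,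
          f (((k : GL (Fin 2) F) : Matrix (Fin 2) (Fin 2) F) * !![r 0, r 1; 0, r 2] * ((((k : GL (Fin 2) F))⁻¹ : GL (Fin 2) F) : Matrix (Fin 2) (Fin 2) F))
          ∂(Measure.pi fun _ : Fin 3 => dx) ∂κ := by
  haveI : T2Space F := (isLocalField F).toT2Space
  haveI : LocallyCompactSpace F := (isLocalField F).toLocallyCompactSpace
  haveI : SecondCountableTopology F := secondCountableTopology_localField F
  haveI : CompactSpace ↥(glInt 2 F) := isCompact_iff_compactSpace.1 (isCompact_glInt 2 F)
  haveI : IsFiniteMeasure κ := CompactSpace.isFiniteMeasure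
  obtain ⟨c, hc, hline⟩ := integral_matrixFourier_conjNilp_eq ψ hψ μ𝔤 dx
  refine ⟨c, hc, fun f hf => ?_⟩
  rw [integral_prod _ (integrable_comp_conjNilp κ dx (isLocSmooth_matrixFourier hψ μ𝔤 hf))]
  refine (integral_congr_ae (Filter.Eventually.of_forall fun k : ↥(glInt 2 F) => hline k.2 hf)).trans ?_
  rw [integral_const_mul]

end Head

end Summit.HodgeConjecture.HodgeConjecture.Cruxes.H413.K2E3GL2RegularNilpotentFourierLineInversion

end
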